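import Literature.MathematicalPhysics.QuantumFieldTheory.QCDFlavourSymmetry
import Literature.MathematicalPhysics.QuantumFieldTheory.QCDObservableAxisPermutation
import HarnessLib

/-!
# Crux `TorusHalfSpectrum` (stmt-QuantumFields-9508), line `registered` (`Lines/birth.lean`, reshape v3) —
# stub `stub_neutral_gap_along_axes`: the common-threshold neutral gap along every lattice axis

Stub of the birth skeleton of the crux
`Summit.QuantumFields.QCD.Theses.QuarksNoInfraredClause.TorusHalfSpectrum` (= `TransportStmt`): the
COMMON-THRESHOLD flavour-neutral lattice gap — for every pair of flavour-neutral gauge-invariant local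
observables `A, B` there is `C` with `‖⟨A(0)·B(n e₀)⟩ − ⟨A⟩⟨B⟩‖ ≤ C e^{−Δ' a_k n}` for ALL `k ≥ k₀`, on every
torus `2S+1 ≥ 2L_k+1`, for all Euclidean times `n ≤ S` — holds verbatim along EVERY coordinate axis `eᵢ`
(the spatial clustering consumed by the Haag splitting of the light core), with the same threshold `k₀`.

Proof (pattern of `QCDScheme.HasLatticeMassGap.along_axis`): for `i = 0` this is the hypothesis
(`qcdLatticeConnectedCorr` unfolded); for `i ≠ 0` apply the hypothesis to the pair of axis-permuted observables
`A.axisPerm π S S'`, `B.axisPerm π S S'` for the transposition `π = (0 i)` and its spinor intertwiner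
(`transpositionSpinor_intertwines`), and transport by the hypercubic covariance of the honest functional
(`qcdTorusExpect_axisPerm_onTorus(_mul)`).  The one new ingredient: **the axis permutation of a flavour-neutral
observable is flavour-neutral** (`isFlavourNeutral_axisPerm`) — the vector flavour torus (diagonal weights
`t_f^{∓1}` on the generators `ψ̄_f`, `ψ_f`) commutes with the axis map of generator coefficients, which mixes
only site and spin at fixed flavour and fixed `ψ̄/ψ` type (`flavourLin_comp_boxAxisLin`), hence with the induced
algebra endomorphisms (`flavourScale_boxAxisPerm`).  Everything is proved (no named fact); sources as in
`QCDObservableAxisPermutation.lean` (Montvay–Münster 1994 §4.2, §5.1; Osterwalder–Seiler 1978 §2).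
-/

noncomputable section

namespace Summit.QuantumFields.QCD.Cruxes.TorusHalfSpectrum.Birth.NeutralGapAlongAxes

open Filter
open Literature.MathematicalPhysics.QuantumFieldTheory

variable {Nf R : ℕ}

/-! ### The flavour torus commutes with the axis permutation -/

/-- **The diagonal flavour weights commute with the axis map on generator coefficients**: the axis map
`boxAxisLin π S S'` sends the coefficient of `ψ̄_{f,x,a,α}` (resp. `ψ_{f,x,a,α}`) to a spin combination of
coefficients of `ψ̄_{f,π⁻¹x,a,·}` (resp. `ψ_{f,π⁻¹x,a,·}`) — same flavour, same type — on which the flavour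
weight is the same constant `t_f⁻¹` (resp. `t_f`). -/
theorem flavourLin_comp_boxAxisLin (t : Fin Nf → ℂ) (π : Equiv.Perm (Fin 4)) (S S' : Matrix (Fin 4) (Fin 4) ℂ) :
    (LinearMap.pi fun w => QCDLatticeObservable.flavourWeight t w •
        (LinearMap.proj w : (BoxFermiIdx Nf R ⊕ₗ BoxFermiIdx Nf R → ℂ) →ₗ[ℂ] ℂ)) ∘ₗ boxAxisLin π S S' =
      boxAxisLin π S S' ∘ₗ (LinearMap.pi fun w => QCDLatticeObservable.flavourWeight t w •
        (LinearMap.proj w : (BoxFermiIdx Nf R ⊕ₗ BoxFermiIdx Nf R → ℂ) →ₗ[ℂ] ℂ)) := by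
  refine LinearMap.ext fun c => funext fun w => ?_
  obtain ⟨x, rfl⟩ : ∃ x, toLex x = w := ⟨ofLex w, rfl⟩
  rcases x with i | i
  · simp only [LinearMap.comp_apply, boxAxisLin, LinearMap.pi_apply, ofLex_toLex, LinearMap.coe_sum,
      Finset.sum_apply, LinearMap.smul_apply, LinearMap.proj_apply, Equiv.symm_apply_apply, smul_eq_mul,
      Finset.mul_sum, QCDLatticeObservable.flavourWeight_inl]
    refine Finset.sum_congr rfl fun α _ => ?_
    ring
  · simp only [LinearMap.comp_apply, boxAxisLin, LinearMap.pi_apply, ofLex_toLex, LinearMap.coe_sum,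
      Finset.sum_apply, LinearMap.smul_apply, LinearMap.proj_apply, Equiv.symm_apply_apply, smul_eq_mul,
      Finset.mul_sum, QCDLatticeObservable.flavourWeight_inr]
    refine Finset.sum_congr rfl fun α _ => ?_
    ring

/-- **The vector flavour torus commutes with the axis permutation of the boxed quark Grassmann algebra**:
`t · (L y) = L (t · y)`. -/
theorem flavourScale_boxAxisPerm (t : Fin Nf → ℂ) (π : Equiv.Perm (Fin 4)) (S S' : Matrix (Fin 4) (Fin 4) ℂ)
    (y : BoxFermiAlg Nf R) :
    QCDLatticeObservable.flavourScale t (boxAxisPerm Nf R π S S' y) =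
      boxAxisPerm Nf R π S S' (QCDLatticeObservable.flavourScale t y) := by
  rw [QCDLatticeObservable.flavourScale_eq, boxAxisPerm, ← AlgHom.comp_apply, ExteriorAlgebra.map_comp_map,
    flavourLin_comp_boxAxisLin, ← ExteriorAlgebra.map_comp_map, AlgHom.comp_apply]

/-- **The axis permutation of a flavour-neutral observable is flavour-neutral.** -/
theorem isFlavourNeutral_axisPerm {A : QCDLatticeObservable Nf R} (hA : A.IsFlavourNeutral)
    (π : Equiv.Perm (Fin 4)) (S S' : Matrix (Fin 4) (Fin 4) ℂ) : (A.axisPerm π S S').IsFlavourNeutral := by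
  intro t ht U
  rw [QCDLatticeObservable.axisPerm_F, flavourScale_boxAxisPerm, hA t ht]

/-! ### The registered stub -/

/-- **Stub `stub_neutral_gap_along_axes` of the birth skeleton of `TorusHalfSpectrum` (= `TransportStmt`)**:
the common-threshold flavour-neutral lattice gap (threshold `k₀`, rate `Δ'`, stated along the Euclidean-time
axis `e₀` inside `qcdLatticeConnectedCorr`) holds along every coordinate axis `eᵢ` with the same threshold,
rate and quantifier shape: for `i ≠ 0` apply the hypothesis to the (again neutral, `isFlavourNeutral_axisPerm`)
axis-permuted pair for the transposition `(0 i)` and transport by `qcdTorusExpect_axisPerm_onTorus(_mul)`. -/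
theorem stub_neutral_gap_along_axes :
    ∀ (Nf : ℕ) (sch : QCDScheme Nf) (Δ' : ℝ) (k₀ : ℕ),
      (∀ (R R' : ℕ) (A : QCDLatticeObservable Nf R) (B : QCDLatticeObservable Nf R'),
          A.IsFlavourNeutral → B.IsFlavourNeutral → ∃ C : ℝ, ∀ k : ℕ, k₀ ≤ k →
            ∀ S : ℕ, sch.L k ≤ S → ∀ n : ℕ, n ≤ S →
              ‖qcdLatticeConnectedCorr (sch.β k) (2 * S + 1) (fun fl => sch.mq fl k) A B n‖ ≤
                C * Real.exp (-(Δ' * (sch.a k * n)))) →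
      ∀ (i : Fin 4) (R R' : ℕ) (A : QCDLatticeObservable Nf R) (B : QCDLatticeObservable Nf R'),
        A.IsFlavourNeutral → B.IsFlavourNeutral → ∃ C : ℝ, ∀ k : ℕ, k₀ ≤ k →
          ∀ S : ℕ, sch.L k ≤ S → ∀ n : ℕ, n ≤ S →
            ‖qcdTorusExpect (sch.β k) (2 * S + 1) (fun fl => sch.mq fl k)
                  (fun U => A.onTorus (2 * S + 1) 0 U *
                    B.onTorus (2 * S + 1) (Pi.single i (n : ℤ)) U) -
                qcdTorusExpect (sch.β k) (2 * S + 1) (fun fl => sch.mq fl k) (A.onTorus (2 * S + 1) 0) *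
                  qcdTorusExpect (sch.β k) (2 * S + 1) (fun fl => sch.mq fl k)
                    (B.onTorus (2 * S + 1) (Pi.single i (n : ℤ)))‖ ≤
              C * Real.exp (-(Δ' * (sch.a k * n))) := by
  intro Nf sch Δ' k₀ h i R R' A B hA hB
  rcases eq_or_ne i 0 with rfl | hi
  · -- the time axis itself: the hypothesis, `qcdLatticeConnectedCorr` unfolded
    obtain ⟨C, hC⟩ := h R R' A B hA hB
    exact ⟨C, hC⟩
  · set π : Equiv.Perm (Fin 4) := Equiv.swap 0 i with hπ
    have hS := transpositionSpinor_intertwines hi.symm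
    obtain ⟨C, hC⟩ := h R R' (A.axisPerm π (transpositionSpinor 0 i) (transpositionSpinorInv 0 i))
      (B.axisPerm π (transpositionSpinor 0 i) (transpositionSpinorInv 0 i))
      (isFlavourNeutral_axisPerm hA π (transpositionSpinor 0 i) (transpositionSpinorInv 0 i))
      (isFlavourNeutral_axisPerm hB π (transpositionSpinor 0 i) (transpositionSpinorInv 0 i))
    refine ⟨C, fun k hk T hT n hn => ?_⟩
    have key := hC k hk T hT n hn
    rw [qcdLatticeConnectedCorr] at key
    have h0 : sitePermZd π (0 : Literature.Probability.LatticeModels.Site 4) = 0 := sitePermZd_zero π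
    have hn' : sitePermZd π (Pi.single i (n : ℤ) : Literature.Probability.LatticeModels.Site 4) =
        Pi.single 0 (n : ℤ) := by
      rw [sitePermZd_single, hπ, Equiv.swap_apply_right]
    rw [← h0, ← hn', qcdTorusExpect_axisPerm_onTorus_mul hS,
      show ((A.axisPerm π (transpositionSpinor 0 i) (transpositionSpinorInv 0 i)).onTorus (2 * T + 1) (sitePermZd π 0)) =
        fun U => (A.axisPerm π (transpositionSpinor 0 i) (transpositionSpinorInv 0 i)).onTorus (2 * T + 1)
          (sitePermZd π 0) U from rfl,
      qcdTorusExpect_axisPerm_onTorus hS,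
      show ((B.axisPerm π (transpositionSpinor 0 i) (transpositionSpinorInv 0 i)).onTorus (2 * T + 1)
          (sitePermZd π (Pi.single i (n : ℤ)))) =
        fun U => (B.axisPerm π (transpositionSpinor 0 i) (transpositionSpinorInv 0 i)).onTorus (2 * T + 1)
          (sitePermZd π (Pi.single i (n : ℤ))) U from rfl,
      qcdTorusExpect_axisPerm_onTorus hS] at key
    exact key

end Summit.QuantumFields.QCD.Cruxes.TorusHalfSpectrum.Birth.NeutralGapAlongAxes

end
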